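import Mathlib
import Summits.KontsevichZagierPeriods.KontsevichZagierPeriods.Theses.InverseLandau

/-!
# `TateLifting`, line `Sketch`, stub `stub_ratPolyDense` — rational Weierstrass with pinned nodes

Crux stmt-KontsevichZagierPeriods-9129 (`Summit.KontsevichZagierPeriods.KontsevichZagierPeriods.Theses.InverseLandau.TateLifting`).
For real-algebraic `θ > 0` whose minimal polynomial `m` has no root in `(0,θ)`, the functions
`t·m(t)·q(t)`, `q ∈ ℚ[X]`, are uniformly dense in the continuous functions on `[0,θ]` vanishing at
`0` and `θ`.

The proof is elementary: cut `g` off near the two pinned nodes (where it is small), divide by the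
weight `w(t) = t·m(t)` away from the nodes (where `w` is bounded away from zero), apply the
Weierstrass approximation theorem to the quotient, and finally replace the real coefficients of
the approximating polynomial by nearby rationals.
-/

noncomputable section

namespace Summit.KontsevichZagierPeriods.InverseLandau

open Literature.NumberTheory.Transcendental

/-- A continuous piecewise-linear plateau: values in `[0,1]`, vanishing below `a + η` and above
`b - η`, and equal to `1` on `[a + 2η, b - 2η]`. [folklore] -/
private lemma ratPolyDense_plateau (a b : ℝ) {η : ℝ} (hη : 0 < η) :
    ∃ ψ : ℝ → ℝ, Continuous ψ ∧ (∀ t, 0 ≤ ψ t) ∧ (∀ t, ψ t ≤ 1) ∧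
      (∀ t, t < a + η → ψ t = 0) ∧ (∀ t, b - η < t → ψ t = 0) ∧
      (∀ t, a + 2 * η ≤ t → t ≤ b - 2 * η → ψ t = 1) := by
  refine ⟨fun t => min 1 (max 0 (min ((t - a - η) / η) ((b - η - t) / η))),
    ?_, ?_, ?_, ?_, ?_, ?_⟩
  · fun_prop
  · intro t
    exact le_min zero_le_one (le_max_left _ _)
  · intro t
    exact min_le_left _ _
  · intro t ht
    have h1 : (t - a - η) / η < 0 := div_neg_of_neg_of_pos (by linarith) hη
    have h2 : min ((t - a - η) / η) ((b - η - t) / η) ≤ 0 := (min_le_left _ _).trans h1.le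
    simp only [max_eq_left h2, min_eq_right (zero_le_one' ℝ)]
  · intro t ht
    have h1 : (b - η - t) / η < 0 := div_neg_of_neg_of_pos (by linarith) hη
    have h2 : min ((t - a - η) / η) ((b - η - t) / η) ≤ 0 := (min_le_right _ _).trans h1.le
    simp only [max_eq_left h2, min_eq_right (zero_le_one' ℝ)]
  · intro t h1 h2
    have h3 : 1 ≤ (t - a - η) / η := by rw [le_div_iff₀ hη]; linarith
    have h4 : 1 ≤ (b - η - t) / η := by rw [le_div_iff₀ hη]; linarith
    have h5 : 1 ≤ max 0 (min ((t - a - η) / η) ((b - η - t) / η)) :=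
      (le_min h3 h4).trans (le_max_right _ _)
    exact min_eq_left h5

/-- Clamping the argument of `w` into `[a + η, b - η] ⊆ (a, b)` produces a continuous,
nowhere-vanishing function agreeing with `w` on `[a + η, b - η]`. [folklore] -/
private lemma ratPolyDense_clamp {a b η : ℝ} {w : ℝ → ℝ} (hw : ContinuousOn w (Set.Icc a b))
    (hw0 : ∀ t ∈ Set.Ioo a b, w t ≠ 0) (hη : 0 < η) (hηab : η < b - a) :
    ∃ w₁ : ℝ → ℝ, Continuous w₁ ∧ (∀ t, w₁ t ≠ 0) ∧
      ∀ t ∈ Set.Icc (a + η) (b - η), w₁ t = w t := by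
  have hcl : ∀ t, max (a + η) (min t (b - η)) ∈ Set.Ioo a b := fun t =>
    ⟨by linarith [le_max_left (a + η) (min t (b - η))],
      max_lt (by linarith) ((min_le_right _ _).trans_lt (by linarith))⟩
  refine ⟨fun t => w (max (a + η) (min t (b - η))), ?_, fun t => hw0 _ (hcl t), ?_⟩
  · exact hw.comp_continuous (f := fun t => max (a + η) (min t (b - η))) (by fun_prop)
      fun t => Set.Ioo_subset_Icc_self (hcl t)
  · intro t ht
    simp only [min_eq_left ht.2, max_eq_right ht.1]

/-- **Weierstrass with pinned nodes, real form.** If `w` is continuous on `[a,b]` and vanishes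
nowhere on `(a,b)`, then every continuous `g` on `[a,b]` with `g a = g b = 0` is a uniform limit
on `[a,b]` of functions `w · P` with `P ∈ ℝ[X]`. [folklore] -/
private lemma ratPolyDense_real {a b : ℝ} (hab : a < b) {w g : ℝ → ℝ}
    (hw : ContinuousOn w (Set.Icc a b)) (hw0 : ∀ t ∈ Set.Ioo a b, w t ≠ 0)
    (hg : ContinuousOn g (Set.Icc a b)) (hga : g a = 0) (hgb : g b = 0) {ε : ℝ} (hε : 0 < ε) :
    ∃ P : Polynomial ℝ, ∀ t ∈ Set.Icc a b, |g t - w t * P.eval t| < ε := by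
  -- Step A: continuity of `g` at the two pinned nodes gives a margin `η`.
  have hε2 : 0 < ε / 2 := by positivity
  obtain ⟨δa, hδa, hga'⟩ :=
    Metric.continuousWithinAt_iff.mp (hg a (Set.left_mem_Icc.mpr hab.le)) (ε / 2) hε2
  obtain ⟨δb, hδb, hgb'⟩ :=
    Metric.continuousWithinAt_iff.mp (hg b (Set.right_mem_Icc.mpr hab.le)) (ε / 2) hε2
  obtain ⟨η, hη, hηa, hηb, hηab⟩ :
      ∃ η : ℝ, 0 < η ∧ η ≤ δa / 3 ∧ η ≤ δb / 3 ∧ η ≤ (b - a) / 4 :=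
    ⟨min (δa / 3) (min (δb / 3) ((b - a) / 4)),
      lt_min (by linarith) (lt_min (by linarith) (by linarith)), min_le_left _ _,
      (min_le_right _ _).trans (min_le_left _ _), (min_le_right _ _).trans (min_le_right _ _)⟩
  obtain ⟨ψ, hψc, hψ0, hψ1, hψa, hψb, hψm⟩ := ratPolyDense_plateau a b hη
  obtain ⟨w₁, hw₁c, hw₁0, hw₁eq⟩ := ratPolyDense_clamp hw hw0 hη (by linarith)
  -- Step B: `h := ψ g / w₁` is continuous on `[a,b]` and `w · h = ψ · g` there.
  set h : ℝ → ℝ := fun t => ψ t * g t / w₁ t with hh_def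
  have hhc : ContinuousOn h (Set.Icc a b) :=
    ContinuousOn.div₀ (hψc.continuousOn.mul hg) hw₁c.continuousOn fun t _ => hw₁0 t
  have hwh : ∀ t ∈ Set.Icc a b, w t * h t = ψ t * g t := by
    intro t ht
    by_cases hmid : t ∈ Set.Icc (a + η) (b - η)
    · have hwt : w t ≠ 0 := hw0 t ⟨by linarith [hmid.1], by linarith [hmid.2]⟩
      simp only [hh_def, hw₁eq t hmid]
      field_simp
    · have hψt : ψ t = 0 := by
        rcases not_and_or.mp hmid with h1 | h1
        · exact hψa t (lt_of_not_ge h1)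
        · exact hψb t (lt_of_not_ge h1)
      simp [hh_def, hψt]
  -- Step C: a bound for `|w|` on `[a,b]` and Weierstrass for `h`.
  obtain ⟨C, hC⟩ := isCompact_Icc.exists_bound_of_continuousOn hw
  have hC0 : 0 ≤ |C| := abs_nonneg C
  obtain ⟨δ, hδ, hδ_def⟩ : ∃ δ : ℝ, 0 < δ ∧ δ = ε / (2 * (|C| + 1)) :=
    ⟨_, by positivity, rfl⟩
  obtain ⟨P, hP⟩ := exists_polynomial_near_of_continuousOn a b h hhc δ hδ
  refine ⟨P, fun t ht => ?_⟩
  -- Step D: the estimate `|g - w P| ≤ |g - ψ g| + |w| |h - P|`.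
  have e1 : |g t - ψ t * g t| < ε / 2 := by
    by_cases hmid : a + 2 * η ≤ t ∧ t ≤ b - 2 * η
    · rw [hψm t hmid.1 hmid.2, one_mul, sub_self, abs_zero]
      exact hε2
    · have hgt : |g t| < ε / 2 := by
        rcases not_and_or.mp hmid with h1 | h1
        · have hd : dist t a < δa := by
            rw [Real.dist_eq, abs_of_nonneg (by linarith [ht.1])]
            linarith [lt_of_not_ge h1]
          have := hga' ht hd
          rwa [hga, Real.dist_eq, sub_zero] at this
        · have hd : dist t b < δb := by
            rw [Real.dist_eq, abs_of_nonpos (by linarith [ht.2])]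
            linarith [lt_of_not_ge h1]
          have := hgb' ht hd
          rwa [hgb, Real.dist_eq, sub_zero] at this
      have hfac : g t - ψ t * g t = (1 - ψ t) * g t := by ring
      rw [hfac, abs_mul, abs_of_nonneg (by linarith [hψ1 t])]
      calc (1 - ψ t) * |g t| ≤ 1 * |g t| :=
            mul_le_mul_of_nonneg_right (by linarith [hψ0 t]) (abs_nonneg _)
        _ < ε / 2 := by rw [one_mul]; exact hgt
  have e2 : |ψ t * g t - w t * P.eval t| < ε / 2 := by
    rw [← hwh t ht, ← mul_sub, abs_mul]
    have hPt : |h t - P.eval t| < δ := by rw [abs_sub_comm]; exact hP t ht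
    have hwt : |w t| ≤ |C| := (Real.norm_eq_abs (w t) ▸ hC t ht).trans (le_abs_self C)
    calc |w t| * |h t - P.eval t| ≤ |C| * δ := mul_le_mul hwt hPt.le (abs_nonneg _) hC0
      _ < (|C| + 1) * δ := mul_lt_mul_of_pos_right (by linarith) hδ
      _ = ε / 2 := by rw [hδ_def]; field_simp
  calc |g t - w t * P.eval t|
      = |(g t - ψ t * g t) + (ψ t * g t - w t * P.eval t)| := by rw [sub_add_sub_cancel]
    _ ≤ |g t - ψ t * g t| + |ψ t * g t - w t * P.eval t| := abs_add_le _ _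
    _ < ε / 2 + ε / 2 := add_lt_add e1 e2
    _ = ε := by ring

/-- Every real polynomial is uniformly approximated on bounded sets by polynomials with rational
coefficients. [folklore] -/
private lemma ratPolyDense_ratApprox (P : Polynomial ℝ) (R : ℝ) :
    ∀ δ : ℝ, 0 < δ → ∃ q : Polynomial ℚ, ∀ t : ℝ, |t| ≤ R →
      |P.eval t - Polynomial.aeval t q| < δ := by
  induction P using Polynomial.induction_on' with
  | add p q hp hq =>
    intro δ hδ
    obtain ⟨p₁, hp₁⟩ := hp (δ / 2) (by positivity)
    obtain ⟨q₁, hq₁⟩ := hq (δ / 2) (by positivity)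
    refine ⟨p₁ + q₁, fun t ht => ?_⟩
    rw [Polynomial.eval_add, map_add]
    calc |p.eval t + q.eval t - (Polynomial.aeval t p₁ + Polynomial.aeval t q₁)|
        = |(p.eval t - Polynomial.aeval t p₁) + (q.eval t - Polynomial.aeval t q₁)| := by
          rw [add_sub_add_comm]
      _ ≤ |p.eval t - Polynomial.aeval t p₁| + |q.eval t - Polynomial.aeval t q₁| :=
          abs_add_le _ _
      _ < δ / 2 + δ / 2 := add_lt_add (hp₁ t ht) (hq₁ t ht)
      _ = δ := by ring
  | monomial n c =>
    intro δ hδ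
    have hR : 0 < |R| ^ n + 1 := by positivity
    have hδ' : 0 < δ / (|R| ^ n + 1) := div_pos hδ hR
    obtain ⟨r, hr1, hr2⟩ := exists_rat_btwn
      (show c - δ / (|R| ^ n + 1) < c + δ / (|R| ^ n + 1) by linarith)
    refine ⟨Polynomial.monomial n r, fun t ht => ?_⟩
    have hcr : |c - r| < δ / (|R| ^ n + 1) := by
      rw [abs_sub_lt_iff]; constructor <;> linarith
    have hev : (Polynomial.aeval t (Polynomial.monomial n r) : ℝ) = (r : ℝ) * t ^ n := by
      rw [Polynomial.aeval_monomial, eq_ratCast]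
    rw [Polynomial.eval_monomial, hev, ← sub_mul, abs_mul, abs_pow]
    have htR : |t| ^ n ≤ |R| ^ n := pow_le_pow_left₀ (abs_nonneg t) (ht.trans (le_abs_self R)) n
    calc |c - r| * |t| ^ n ≤ |c - r| * |R| ^ n := mul_le_mul_of_nonneg_left htR (abs_nonneg _)
      _ ≤ |c - r| * (|R| ^ n + 1) := by nlinarith [abs_nonneg (c - (r : ℝ))]
      _ < δ := by rwa [lt_div_iff₀ hR] at hcr

/-- **Rational Weierstrass with pinned nodes** (stub `stub_ratPolyDense` of line `Sketch` for crux
`TateLifting`). [folklore] -/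
theorem tateLifting_ratPolyDense :
    ∀ (θ : ℝ) (g : ℝ → ℝ) (ε : ℝ), IsAlgebraic ℚ θ → 0 < θ → 0 < ε →
      (∀ t ∈ Set.Ioo (0 : ℝ) θ, Polynomial.aeval t (minpoly ℚ θ) ≠ 0) →
      ContinuousOn g (Set.Icc 0 θ) → g 0 = 0 → g θ = 0 →
      ∃ q : Polynomial ℚ, ∀ t ∈ Set.Icc (0 : ℝ) θ,
        |g t - t * Polynomial.aeval t (minpoly ℚ θ) * Polynomial.aeval t q| < ε := by
  intro θ g ε _ hθ hε hroot hg hg0 hgθ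
  -- The weight `w(t) = t · m(t)` is continuous and vanishes nowhere on `(0, θ)`.
  set w : ℝ → ℝ := fun t => t * Polynomial.aeval t (minpoly ℚ θ) with hw_def
  have hwc : ContinuousOn w (Set.Icc 0 θ) := by
    apply Continuous.continuousOn
    show Continuous fun t : ℝ => t * Polynomial.aeval t (minpoly ℚ θ)
    fun_prop
  have hw0 : ∀ t ∈ Set.Ioo (0 : ℝ) θ, w t ≠ 0 := fun t ht => mul_ne_zero ht.1.ne' (hroot t ht)
  have hε2 : 0 < ε / 2 := by positivity
  -- Real approximation `|g - w P| < ε / 2`, then rational approximation of `P`.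
  obtain ⟨P, hP⟩ := ratPolyDense_real hθ hwc hw0 hg hg0 hgθ hε2
  obtain ⟨C, hC⟩ := isCompact_Icc.exists_bound_of_continuousOn hwc
  have hC0 : 0 ≤ |C| := abs_nonneg C
  obtain ⟨δ, hδ, hδ_def⟩ : ∃ δ : ℝ, 0 < δ ∧ δ = ε / (2 * (|C| + 1)) :=
    ⟨_, by positivity, rfl⟩
  obtain ⟨q, hq⟩ := ratPolyDense_ratApprox P θ δ hδ
  refine ⟨q, fun t ht => ?_⟩
  have htabs : |t| ≤ θ := abs_le.mpr ⟨by linarith [ht.1], ht.2⟩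
  have e2 : |w t * P.eval t - w t * Polynomial.aeval t q| < ε / 2 := by
    rw [← mul_sub, abs_mul]
    have hwt : |w t| ≤ |C| := (Real.norm_eq_abs (w t) ▸ hC t ht).trans (le_abs_self C)
    calc |w t| * |P.eval t - Polynomial.aeval t q| ≤ |C| * δ :=
          mul_le_mul hwt (hq t htabs).le (abs_nonneg _) hC0
      _ < (|C| + 1) * δ := mul_lt_mul_of_pos_right (by linarith) hδ
      _ = ε / 2 := by rw [hδ_def]; field_simp
  show |g t - w t * Polynomial.aeval t q| < ε
  calc |g t - w t * Polynomial.aeval t q|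
      = |(g t - w t * P.eval t) + (w t * P.eval t - w t * Polynomial.aeval t q)| := by
        rw [sub_add_sub_cancel]
    _ ≤ |g t - w t * P.eval t| + |w t * P.eval t - w t * Polynomial.aeval t q| := abs_add_le _ _
    _ < ε / 2 + ε / 2 := add_lt_add (hP t ht) e2
    _ = ε := by ring

end Summit.KontsevichZagierPeriods.InverseLandau

end
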